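import Mathlib.Analysis.InnerProductSpace.l2Space
import Mathlib.Analysis.SpecialFunctions.Pow.Real
import HarnessLib

/-!
# NS-claims map, C01 (Otelbaev 2013), `ℓ²` model file: the infinite-dimensional 2014 counterexample
# in ONE space (interface-independent facts)

Model for the kill of the charitable PER-SPACE reading `Literature.Claims.NS.Otelbaev2013.Theorem61PerSpace`
of Theorem 6.1 (Мат. журнал **13** (2013) no. 4, p. 29), packaged against the typed `Setting` in
`SoloRefuteOtelbaev2013PerSpace.lean`.  In every fixed finite-dimensional space the per-space reading
holds (p. 62), so the 53-dimensional family of `SoloRefuteOtelbaev2013Model` (the tree's kill of the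
printed, dimension-free `Theorem61`, p465918) does not touch it; the ORIGINAL witness of the 2014
discussion (dxdy.ru topic 80156, post p817605; English account by S. Montgomery-Smith; bib
`DxdyTopic80156`, `MontgomerySmith2014Otelbaev`) lives in one infinite-dimensional space:

* `Ĥ = ℓ²(ℕ, ℝ)` (Mathlib `lp (fun _ : ℕ => ℝ) 2`) with its standard Hilbert basis `e₀, e₁, …` (`hb`,
  the identity representation; `⟪eᵢ, u⟫ = uᵢ`);
* eigenvalues `ev`: `λₙ = 1 (n ≤ 50)`, `λ₅₁ = 50`, `λₙ = n (n ≥ 52)` — `λ₁ = 1` with a 51-dimensional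
  eigenspace, `λ₂ = 50 ∈ [16, 100]`, then the simple eigenvalues `52 < 53 < …`, finitely many below
  every level;
* `L(u, v) = Σ_{k ≥ 26} (u_{2k} v_{2k+1} / k) (e_{2k} + e_{2k+1})` as an element `Lv u v ∈ ℓ²`
  (coefficients `Lfun`; square-summable since `|L(u,v)ₙ| ≤ |u_{2(n/2)}| ‖v‖`), additive and homogeneous
  in each argument, vanishing when an argument vanishes from index `52` on, with `range L` orthogonal
  to such vectors, and `L(u,u) = 0` whenever the non-zero coordinates of `u` carry one eigenvalue.

The norm bound (У.1), the witnesses and the typed packaging are in `SoloRefuteOtelbaev2013PerSpace.lean`.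
Design of the model in this cell: ns-claims-typist-1 g5 (INBOX 2026-08-27T09:11:18Z (α)); built by
ns-claims-salvage-p4 g4.  Axioms: `propext`, `Classical.choice`, `Quot.sound` only.
WHAT THIS IS NOT: not a claim about NS regularity or blow-up; not a claim about any author beyond
the typed locator.
-/

noncomputable section

open Real

-- The summit's canonical theorem namespace repeats the summit name (single-conjunct summit).
set_option linter.dupNamespace false

namespace Summit.NavierStokesRegularity.NavierStokesRegularity.Theorems.Otelbaev2013

namespace Ell2

/-! ## The space `ℓ²(ℕ, ℝ)` and its standard Hilbert basis -/

/-- The model space `Ĥ = ℓ²(ℕ, ℝ)`. -/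
abbrev H : Type := lp (fun _ : ℕ => ℝ) 2

/-- The standard Hilbert basis of `ℓ²(ℕ, ℝ)` (the identity representation). -/
def hb : HilbertBasis ℕ ℝ H := HilbertBasis.ofRepr (LinearIsometryEquiv.refl ℝ H)

/-- Coefficients against the standard basis are coordinates: `⟪eᵢ, u⟫ = uᵢ`. -/
@[simp] theorem inner_hb (i : ℕ) (u : H) : inner ℝ (hb i) u = u i := by
  rw [← HilbertBasis.repr_apply_apply]; rfl

/-- For `u ∈ ℓ²`, `Σ uᵢ²` converges to `‖u‖²`. -/
theorem hasSum_sq (u : H) : HasSum (fun i => (u i) ^ 2) (‖u‖ ^ 2) := by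
  have h := lp.hasSum_norm (by norm_num : 0 < (2 : ENNReal).toReal) u
  simp only [ENNReal.toReal_ofNat, Real.rpow_two, Real.norm_eq_abs, sq_abs] at h
  exact h

/-- For `u ∈ ℓ²`, `Σ uᵢ²` is summable. -/
theorem summable_sq (u : H) : Summable (fun i => (u i) ^ 2) := (hasSum_sq u).summable

/-- `‖u‖² = Σ uᵢ²`. -/
theorem norm_sq_eq_tsum (u : H) : ‖u‖ ^ 2 = ∑' i, (u i) ^ 2 := (hasSum_sq u).tsum_eq.symm

/-- A coordinate is bounded by the norm. -/
theorem abs_apply_le_norm (u : H) (i : ℕ) : |u i| ≤ ‖u‖ := by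
  have h := lp.norm_apply_le_norm (by norm_num : (2 : ENNReal) ≠ 0) u i
  rwa [Real.norm_eq_abs] at h

/-- The even-indexed squares of an `ℓ²` sequence are summable. -/
theorem summable_sq_even (u : H) : Summable (fun k : ℕ => (u (2 * k)) ^ 2) :=
  (summable_sq u).comp_injective (mul_right_injective₀ (two_ne_zero' ℕ))

/-- The odd-indexed squares of an `ℓ²` sequence are summable. -/
theorem summable_sq_odd (u : H) : Summable (fun k : ℕ => (u (2 * k + 1)) ^ 2) := by
  have hinj : Function.Injective (fun k : ℕ => 2 * k + 1) := fun a b h => by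
    simp only at h; omega
  exact (summable_sq u).comp_injective hinj

/-- `Σ_k u_{2k}² ≤ ‖u‖²`. -/
theorem tsum_sq_even_le (u : H) : ∑' k : ℕ, (u (2 * k)) ^ 2 ≤ ‖u‖ ^ 2 := by
  have h := tsum_even_add_odd (f := fun i : ℕ => (u i) ^ 2) (summable_sq_even u) (summable_sq_odd u)
  have h0 : 0 ≤ ∑' k : ℕ, (u (2 * k + 1)) ^ 2 := tsum_nonneg fun _ => sq_nonneg _
  rw [norm_sq_eq_tsum, ← h]
  linarith

/-! ## The eigenvalues -/

/-- Eigenvalues of `A`: `1` on indices `≤ 50` (the eigenspace `G₁`), `50` at index `51`, and `n` at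
every index `n ≥ 52` (the blocks `(2k, 2k+1)`, `k ≥ 26`, carry the simple eigenvalues `2k < 2k+1`). -/
def ev (n : ℕ) : ℝ := if n ≤ 50 then 1 else if n = 51 then 50 else n

/-- `λₙ = 1` for `n ≤ 50`. -/
theorem ev_of_le {n : ℕ} (h : n ≤ 50) : ev n = 1 := by simp [ev, h]

/-- `λ₅₁ = 50`. -/
@[simp] theorem ev_51 : ev 51 = 50 := by simp [ev]

/-- `λₙ = n` for `n ≥ 52`. -/
theorem ev_of_ge {n : ℕ} (h : 52 ≤ n) : ev n = n := by
  simp [ev, show ¬ n ≤ 50 by omega, show n ≠ 51 by omega]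

/-- All eigenvalues are `≥ 1`. -/
theorem one_le_ev (n : ℕ) : 1 ≤ ev n := by
  unfold ev
  split_ifs with h1 h2
  · exact le_rfl
  · norm_num
  · have : (52 : ℝ) ≤ n := by exact_mod_cast (show 52 ≤ n by omega)
    linarith

/-- All eigenvalues are positive. -/
theorem ev_pos (n : ℕ) : 0 < ev n := lt_of_lt_of_le one_pos (one_le_ev n)

/-- `λₙ = 1` exactly on the indices `≤ 50`. -/
theorem ev_eq_one_iff {n : ℕ} : ev n = 1 ↔ n ≤ 50 := by
  refine ⟨fun h => ?_, ev_of_le⟩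
  by_contra hn
  by_cases h51 : n = 51
  · subst h51; simp at h
  · rw [ev_of_ge (by omega)] at h
    have : (52 : ℝ) ≤ n := by exact_mod_cast (show 52 ≤ n by omega)
    linarith

/-- Every eigenvalue other than `1` is `≥ 50` (so `λ₂ = 50`). -/
theorem fifty_le_ev_of_ne_one {n : ℕ} (h : ev n ≠ 1) : 50 ≤ ev n := by
  have hn : ¬ n ≤ 50 := fun hn => h (ev_of_le hn)
  by_cases h51 : n = 51
  · subst h51; simp
  · rw [ev_of_ge (by omega)]
    exact_mod_cast (show 50 ≤ n by omega)

/-- Finitely many eigenvalues below every level ((У.3), last clause). -/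
theorem finite_ev_le (R : ℝ) : (Set.range ev ∩ Set.Iic R).Finite := by
  refine ((Set.finite_Iic (max 51 ⌈R⌉₊)).image ev).subset ?_
  rintro x ⟨⟨n, rfl⟩, hR⟩
  refine ⟨n, ?_, rfl⟩
  simp only [Set.mem_Iic]
  by_cases hn : n ≤ 51
  · exact hn.trans (le_max_left _ _)
  · have h52 : 52 ≤ n := by omega
    have hR' : (n : ℝ) ≤ R := by rwa [Set.mem_Iic, ev_of_ge h52] at hR
    have h' : (n : ℝ) ≤ (⌈R⌉₊ : ℕ) := hR'.trans (Nat.le_ceil R)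
    exact (show n ≤ ⌈R⌉₊ by exact_mod_cast h').trans (le_max_right _ _)


/-- A real power of a positive eigenvalue, squared: `(λ^{-1/2})² = λ⁻¹`. -/
theorem rpow_neg_half_sq {x : ℝ} (hx : 0 < x) : (x ^ (-1 / 2 : ℝ)) ^ 2 = x⁻¹ := by
  rw [← Real.rpow_natCast, ← Real.rpow_mul hx.le]
  norm_num [Real.rpow_neg_one]

/-! ## The bilinear form `L` -/

/-- Coefficient sequence of `L(u,v) = Σ_{k ≥ 26} (u_{2k} v_{2k+1} / k)(e_{2k} + e_{2k+1})`: at an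
index `n ≥ 52` with block index `k = n / 2` the coefficient is `u_{2k} v_{2k+1} / k`, else `0`. -/
def Lfun (u v : ℕ → ℝ) (n : ℕ) : ℝ :=
  if 52 ≤ n then u (2 * (n / 2)) * v (2 * (n / 2) + 1) / (n / 2 : ℕ) else 0

/-- `L` reads nothing below index `52`. -/
theorem Lfun_of_lt {u v : ℕ → ℝ} {n : ℕ} (h : n < 52) : Lfun u v n = 0 := by
  simp [Lfun, not_le.mpr h]

/-- The coefficient on `e_{2k}`, `k ≥ 26`. -/
theorem Lfun_even (u v : ℕ → ℝ) {k : ℕ} (hk : 26 ≤ k) :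
    Lfun u v (2 * k) = u (2 * k) * v (2 * k + 1) / k := by
  have h1 : 2 * k / 2 = k := by omega
  simp [Lfun, show 52 ≤ 2 * k by omega, h1]

/-- The coefficient on `e_{2k+1}`, `k ≥ 26` (the same). -/
theorem Lfun_odd (u v : ℕ → ℝ) {k : ℕ} (hk : 26 ≤ k) :
    Lfun u v (2 * k + 1) = u (2 * k) * v (2 * k + 1) / k := by
  have h1 : (2 * k + 1) / 2 = k := by omega
  simp [Lfun, show 52 ≤ 2 * k + 1 by omega, h1]

/-- Pointwise bound `|L(u,v)ₙ| ≤ |u_{2(n/2)}| · |v_{2(n/2)+1}|`. -/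
theorem abs_Lfun_le (u v : ℕ → ℝ) (n : ℕ) :
    |Lfun u v n| ≤ |u (2 * (n / 2))| * |v (2 * (n / 2) + 1)| := by
  unfold Lfun
  split_ifs with h
  · have hk : (1 : ℝ) ≤ ((n / 2 : ℕ) : ℝ) := by exact_mod_cast (show 1 ≤ n / 2 by omega)
    rw [abs_div, abs_mul, Nat.abs_cast]
    exact div_le_self (by positivity) hk
  · rw [abs_zero]; positivity

/-- The squares `(u_{2(n/2)})²` (each even-indexed square counted twice) are summable. -/
theorem summable_sq_block (u : H) : Summable (fun n : ℕ => (u (2 * (n / 2))) ^ 2) := by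
  have h1 : (fun k : ℕ => (u (2 * (2 * k / 2))) ^ 2) = fun k => (u (2 * k)) ^ 2 := by
    funext k; rw [show 2 * k / 2 = k by omega]
  have h2 : (fun k : ℕ => (u (2 * ((2 * k + 1) / 2))) ^ 2) = fun k => (u (2 * k)) ^ 2 := by
    funext k; rw [show (2 * k + 1) / 2 = k by omega]
  refine Summable.even_add_odd (f := fun n : ℕ => (u (2 * (n / 2))) ^ 2) ?_ ?_
  · show Summable (fun k : ℕ => (u (2 * (2 * k / 2))) ^ 2)
    rw [h1]; exact summable_sq_even u
  · show Summable (fun k : ℕ => (u (2 * ((2 * k + 1) / 2))) ^ 2)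
    rw [h2]; exact summable_sq_even u

/-- `Σ_n (u_{2(n/2)})² = 2 Σ_k (u_{2k})²`. -/
theorem tsum_sq_block (u : H) :
    ∑' n : ℕ, (u (2 * (n / 2))) ^ 2 = 2 * ∑' k : ℕ, (u (2 * k)) ^ 2 := by
  have h1 : (fun k : ℕ => (u (2 * (2 * k / 2))) ^ 2) = fun k => (u (2 * k)) ^ 2 := by
    funext k; rw [show 2 * k / 2 = k by omega]
  have h2 : (fun k : ℕ => (u (2 * ((2 * k + 1) / 2))) ^ 2) = fun k => (u (2 * k)) ^ 2 := by
    funext k; rw [show (2 * k + 1) / 2 = k by omega]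
  have he : Summable (fun k : ℕ => (u (2 * (2 * k / 2))) ^ 2) := by
    rw [h1]; exact summable_sq_even u
  have ho : Summable (fun k : ℕ => (u (2 * ((2 * k + 1) / 2))) ^ 2) := by
    rw [h2]; exact summable_sq_even u
  have h := tsum_even_add_odd (f := fun n : ℕ => (u (2 * (n / 2))) ^ 2) he ho
  have h3 : ∑' k : ℕ, (u (2 * (2 * k / 2))) ^ 2 = ∑' k : ℕ, (u (2 * k)) ^ 2 := by rw [h1]
  have h4 : ∑' k : ℕ, (u (2 * ((2 * k + 1) / 2))) ^ 2 = ∑' k : ℕ, (u (2 * k)) ^ 2 := by rw [h2]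
  have h5 : (∑' k : ℕ, (u (2 * (2 * k / 2))) ^ 2) + ∑' k : ℕ, (u (2 * ((2 * k + 1) / 2))) ^ 2 =
      ∑' n : ℕ, (u (2 * (n / 2))) ^ 2 := h
  rw [h3, h4] at h5
  linarith

/-- `(L(u,v)ₙ)² ≤ ‖v‖² (u_{2(n/2)})²`. -/
theorem sq_Lfun_le (u v : H) (n : ℕ) : (Lfun u v n) ^ 2 ≤ ‖v‖ ^ 2 * (u (2 * (n / 2))) ^ 2 := by
  have h3 : |Lfun u v n| ≤ ‖v‖ * |u (2 * (n / 2))| :=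
    calc |Lfun u v n| ≤ |u (2 * (n / 2))| * |v (2 * (n / 2) + 1)| := abs_Lfun_le u v n
      _ ≤ |u (2 * (n / 2))| * ‖v‖ :=
          mul_le_mul_of_nonneg_left (abs_apply_le_norm v _) (abs_nonneg _)
      _ = ‖v‖ * |u (2 * (n / 2))| := mul_comm _ _
  calc (Lfun u v n) ^ 2 = |Lfun u v n| ^ 2 := (sq_abs _).symm
    _ ≤ (‖v‖ * |u (2 * (n / 2))|) ^ 2 := pow_le_pow_left₀ (abs_nonneg _) h3 2
    _ = ‖v‖ ^ 2 * (u (2 * (n / 2))) ^ 2 := by rw [mul_pow, sq_abs]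

/-- `L(u,v)` is square summable for `u, v ∈ ℓ²`. -/
theorem summable_sq_Lfun (u v : H) : Summable (fun n => (Lfun u v n) ^ 2) :=
  Summable.of_nonneg_of_le (fun _ => sq_nonneg _) (sq_Lfun_le u v) ((summable_sq_block u).mul_left _)

/-- `L(u,v) ∈ ℓ²`. -/
theorem memℓp_Lfun (u v : H) : Memℓp (Lfun u v) 2 := by
  apply memℓp_gen
  simp only [ENNReal.toReal_ofNat, Real.rpow_two, Real.norm_eq_abs, sq_abs]
  exact summable_sq_Lfun u v

/-- `L(u,v)` as an element of `ℓ²`. -/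
def Lv (u v : H) : H := ⟨Lfun u v, memℓp_Lfun u v⟩

/-- Coordinates of `L(u,v)`. -/
@[simp] theorem coe_Lv (u v : H) : ((Lv u v : H) : ℕ → ℝ) = Lfun u v := rfl

/-- `L` is additive in the first argument. -/
theorem Lv_add_left (u u' v : H) : Lv (u + u') v = Lv u v + Lv u' v := by
  apply lp.ext; funext n
  simp only [coe_Lv, lp.coeFn_add, Pi.add_apply]
  unfold Lfun
  split_ifs
  · simp only [Pi.add_apply]; ring
  · simp

/-- `L` is additive in the second argument. -/
theorem Lv_add_right (u v v' : H) : Lv u (v + v') = Lv u v + Lv u v' := by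
  apply lp.ext; funext n
  simp only [coe_Lv, lp.coeFn_add, Pi.add_apply]
  unfold Lfun
  split_ifs
  · simp only [Pi.add_apply]; ring
  · simp

/-- `L` is homogeneous in the first argument. -/
theorem Lv_smul_left (c : ℝ) (u v : H) : Lv (c • u) v = c • Lv u v := by
  apply lp.ext; funext n
  simp only [coe_Lv, lp.coeFn_smul, Pi.smul_apply, smul_eq_mul]
  unfold Lfun
  split_ifs
  · simp only [Pi.smul_apply, smul_eq_mul]; ring
  · simp

/-- `L` is homogeneous in the second argument. -/
theorem Lv_smul_right (c : ℝ) (u v : H) : Lv u (c • v) = c • Lv u v := by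
  apply lp.ext; funext n
  simp only [coe_Lv, lp.coeFn_smul, Pi.smul_apply, smul_eq_mul]
  unfold Lfun
  split_ifs
  · simp only [Pi.smul_apply, smul_eq_mul]; ring
  · simp

/-- `range L ⊥ e` whenever `e` vanishes at all indices `≥ 52`. -/
theorem inner_Lv_eq_zero (u g : H) {e : H} (he : ∀ i, 52 ≤ i → e i = 0) :
    inner ℝ (Lv u g) e = 0 := by
  rw [lp.inner_eq_tsum]
  refine (tsum_congr fun i => ?_).trans tsum_zero
  by_cases hi : 52 ≤ i
  · rw [he i hi, inner_zero_right]
  · have h0 : (Lv u g : H) i = 0 := Lfun_of_lt (by omega)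
    rw [h0, inner_zero_left]

/-- `L(e,v) = 0` whenever `e` vanishes at all indices `≥ 52`. -/
theorem Lv_eq_zero_left {e : H} (he : ∀ i, 52 ≤ i → e i = 0) (v : H) : Lv e v = 0 := by
  apply lp.ext; funext n
  simp only [coe_Lv, lp.coeFn_zero, Pi.zero_apply]
  unfold Lfun
  split_ifs with hn
  · rw [he _ (by omega)]; simp
  · rfl

/-- `L(u,e) = 0` whenever `e` vanishes at all indices `≥ 52`. -/
theorem Lv_eq_zero_right (u : H) {e : H} (he : ∀ i, 52 ≤ i → e i = 0) : Lv u e = 0 := by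
  apply lp.ext; funext n
  simp only [coe_Lv, lp.coeFn_zero, Pi.zero_apply]
  unfold Lfun
  split_ifs with hn
  · rw [he (2 * (n / 2) + 1) (by omega)]; simp
  · rfl

/-- **(У.2) engine**: `L(u,u) = 0` when all non-zero coordinates of `u` carry one eigenvalue (every
block coefficient `u_{2k} u_{2k+1}/k` has a vanishing factor, since `λ_{2k} = 2k ≠ 2k+1 = λ_{2k+1}`). -/
theorem Lv_self_eq_zero_of_eigen {u : H} {lam : ℝ} (h : ∀ i, u i ≠ 0 → ev i = lam) :
    Lv u u = 0 := by
  apply lp.ext; funext n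
  simp only [coe_Lv, lp.coeFn_zero, Pi.zero_apply]
  unfold Lfun
  split_ifs with hn
  · by_cases ha : u (2 * (n / 2)) = 0
    · simp [ha]
    by_cases hb : u (2 * (n / 2) + 1) = 0
    · simp [hb]
    exfalso
    have h1 := h _ ha
    have h2 := h _ hb
    rw [ev_of_ge (by omega)] at h1
    rw [ev_of_ge (by omega)] at h2
    have h3 : ((2 * (n / 2) : ℕ) : ℝ) = ((2 * (n / 2) + 1 : ℕ) : ℝ) := h1.trans h2.symm
    norm_cast at h3
    omega
  · rfl

end Ell2

end Summit.NavierStokesRegularity.NavierStokesRegularity.Theorems.Otelbaev2013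

end
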